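import Summits.Schanuel.Schanuel.Theorems.ZilberEacRationalAsymptote
import Summits.Schanuel.Schanuel.Theorems.ZilberEacBranchPoleFibreGrowth
import Mathlib.RingTheory.Polynomial.Eisenstein.Criterion
import HarnessLib

/-!
# Arbitrary base branches, LXIX: TRANSPORT + GROWTH — a branch with a bad (rational) direction
# becomes a good one after a lattice change of coordinates; the tangential cubic
# `(x₁ - x₀)³ = x₀`

HONEST FRAMING.  Cell `pub-schanuel` (Zilber's Exponential-Algebraic Closedness, case ladder;
host summit Schanuel), seat 2, gen 31.  THEOREM G (`unprojectedDense_of_growth`) is a statement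
about a SEQUENCE of exponential points of `S`, not about a germ; so it can be applied to the images
`Φ_U(p_m) ∈ S^U ∩ Γ_exp` of the exponential points along a branch under a lattice change
`U ∈ SL₂(ℤ)` (`x' = Ux`, `y' = y^U`; tree `unprojectedDense_latticeClosure_iff`).  If along the
place `x₀ = s^{-k}`, `x₁ = X₁(s)` the transported coordinate `x₁' = U₁₀x₀ + U₁₁x₁` is
`γ(s)s^{-M'}` with `M' ≥ 1` and `Re(γ(0)z^{M'}) ≠ 0` for SOME `k`-th root `z` of `2πi`, the growth
computation of file XXXII runs verbatim on `x₁'(Φ_U(p_m))` and gives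
**`unprojectedDense_transportedGrowth`** — density of every irreducible `S` of dimension `≤ 2`
containing the germ `(s^{-k}, X₁(s), ψ(s)s^L, e^{X₁(s)})`; NO hypothesis on the base curve beyond
the place.  This covers branches whose OWN direction is bad (rational real) but which are NOT
asymptotic to a line, e.g. `x₁ = x₀ + x₀^{1/3}` on the cubic **`(x₁ - x₀)³ = x₀`**
(`x₀ = s^{-3}`, `x₁ = s^{-3} + s^{-1}`; `U = (1 0; -1 1)`, `x₁' = x₁ - x₀ = s^{-1}`: `(k, M') = (3, 1)`,
`3 ∤ 2`): **`unprojectedDensityQuestion_tangentialCubic_polyFibre`** — every polynomial fibre over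
it is case ∧ dense (with file LXIV for the fibre value).  Decided instances of an OPEN question
(Mantova–Masser, PLMS 2024 §1 p. 5); EC(3,2) OPEN; NOT Schanuel's conjecture (neither used nor
implied); EAC ⇏ SC.
-/

noncomputable section

open Filter Topology Set Complex Polynomial
open Literature.NumberTheory.Transcendental Literature.ModelTheory.Zilber
open Literature.ModelTheory.ExponentialFields

set_option linter.dupNamespace false

namespace Summit.Schanuel.Schanuel.Theorems

section TransportedGrowth

/-- **THEOREM (transport + growth).**  See the module docstring. [cite: MantovaMasser2023, §1
Further remarks, p. 5 (the question, open in general)] (new) -/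
theorem unprojectedDense_transportedGrowth {S : Set (Fin 2 ⊕ Fin 2 → ℂ)} (hS : IsIrreducibleClosed ℂ S)
    (hdim : zariskiDim ℂ S ≤ (2 : ℕ)) (U V : Matrix (Fin 2) (Fin 2) ℤ) (hUV : U * V = 1) (hVU : V * U = 1)
    {k M' : ℕ} (hk : 1 ≤ k) (hM' : 1 ≤ M') {X₁ γ : ℂ → ℂ} (hγan : AnalyticAt ℂ γ 0)
    (hγ : ∀ᶠ s in 𝓝[≠] (0 : ℂ), (U 1 0 : ℂ) * (s ^ k)⁻¹ + (U 1 1 : ℂ) * X₁ s = γ s * (s ^ M')⁻¹)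
    (hdir : ∃ z : ℂ, z ^ k = 2 * Real.pi * I ∧ (γ 0 * z ^ M').re ≠ 0)
    (L : ℤ) {ψ : ℂ → ℂ} (hψan : AnalyticAt ℂ ψ 0) (hψ0 : ψ 0 ≠ 0)
    (hgerm : ∀ᶠ s in 𝓝[≠] (0 : ℂ),
      (Sum.elim ![(s ^ k)⁻¹, X₁ s] ![ψ s * s ^ L, Complex.exp (X₁ s)] : Fin 2 ⊕ Fin 2 → ℂ) ∈ S) :
    UnprojectedDense S := by
  classical
  have hk0 : k ≠ 0 := by omega
  have hkC : (k : ℂ) ≠ 0 := Nat.cast_ne_zero.2 hk0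
  obtain ⟨z, hz, hzre⟩ := hdir
  -- exponential points along the germ
  obtain ⟨N₀, u, s, -, -, hN₀, hu, hu0, -, -, hsu, hs0, hs, hexp⟩ := exists_poleFibre_expPoints hk L hψan hψ0 hz
  have hsW : Tendsto s atTop (𝓝[≠] (0 : ℂ)) :=
    tendsto_nhdsWithin_iff.2 ⟨hs, Eventually.of_forall hs0⟩
  obtain ⟨J₀, hJ₀⟩ := Filter.eventually_atTop.1 (hsW.eventually (hgerm.and hγ))
  set p : ℕ → Fin 2 ⊕ Fin 2 → ℂ := fun m =>
    Sum.elim ![(s (J₀ + m) ^ k)⁻¹, X₁ (s (J₀ + m))]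
      ![ψ (s (J₀ + m)) * s (J₀ + m) ^ L, Complex.exp (X₁ (s (J₀ + m)))] with hp
  have hpS : ∀ m, p m ∈ S := fun m => (hJ₀ (J₀ + m) (Nat.le_add_right _ _)).1
  have hpc : ∀ m, (U 1 0 : ℂ) * (s (J₀ + m) ^ k)⁻¹ + (U 1 1 : ℂ) * X₁ (s (J₀ + m)) =
      γ (s (J₀ + m)) * (s (J₀ + m) ^ M')⁻¹ := fun m => (hJ₀ (J₀ + m) (Nat.le_add_right _ _)).2
  have hpΓ : ∀ m, p m ∈ expGraph ℂ 2 := by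
    intro m
    rw [mem_expGraph_iff]
    intro i
    rw [Literature.ModelTheory.ExponentialFields.ExponentialRing.complex_exp_eq]
    fin_cases i
    · simp [hp, hexp (J₀ + m)]
    · simp [hp]
  have hpT : ∀ m, p m ∈ torusLocus ℂ 2 := fun m => expGraph_subset_torusLocus (hpΓ m)
  have hne : (S ∩ torusLocus ℂ 2).Nonempty := ⟨p 0, hpS 0, hpT 0⟩
  -- the transported surface and points
  set S' : Set (Fin 2 ⊕ Fin 2 → ℂ) := latticeClosure U S with hS'
  have hS'irr : IsIrreducibleClosed ℂ S' := isIrreducibleClosed_latticeClosure U hS hne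
  have hS'dim : zariskiDim ℂ S' ≤ (2 : ℕ) := by
    rw [hS', zariskiDim_latticeClosure hUV hVU hS hne]; exact hdim
  set p' : ℕ → Fin 2 ⊕ Fin 2 → ℂ := fun m => latticeChange U (p m) with hp'
  have hp'S : ∀ m, p' m ∈ S' := fun m =>
    latticeImage_subset_latticeClosure U S ⟨p m, ⟨hpS m, hpT m⟩, rfl⟩
  have hp'Γ : ∀ m, p' m ∈ expGraph ℂ 2 := fun m => latticeChange_mem_expGraph (hpΓ m)
  have hp'x₁ : ∀ m, p' m (Sum.inl 1) = γ (s (J₀ + m)) * (s (J₀ + m) ^ M')⁻¹ := by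
    intro m
    change latticeChange U (p m) (Sum.inl 1) = _
    rw [latticeChange_inl, intLinMap_two]
    simp only [projAdd, hp, Sum.elim_inl, Matrix.cons_val_zero, Matrix.cons_val_one]
    exact hpc m
  -- the scaled form of `x₁'` (file XXXII verbatim with `Φ ↦ γ`, `M ↦ M'`)
  set α : ℝ := (M' : ℝ) / k with hα
  have hα0 : 0 < α := by rw [hα]; positivity
  set t : ℕ → ℝ := fun m => Real.log ((N₀ + (J₀ + m) : ℕ) : ℝ) with ht
  have htt : Tendsto t atTop atTop := by
    rw [ht]
    refine Real.tendsto_log_atTop.comp (tendsto_natCast_atTop_atTop.comp ?_)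
    exact (tendsto_add_atTop_nat (N₀ + J₀)).congr fun m => by omega
  set B : ℕ → ℂ := fun m => γ (s (J₀ + m)) * z ^ M' * (u (J₀ + m) ^ M')⁻¹ with hB
  have hBt : Tendsto B atTop (𝓝 (γ 0 * z ^ M' * (1 ^ M')⁻¹)) := by
    have hsJ : Tendsto (fun m => s (J₀ + m)) atTop (𝓝 0) :=
      hs.comp ((tendsto_add_atTop_nat J₀).congr fun m => by ring)
    have huJ : Tendsto (fun m => u (J₀ + m)) atTop (𝓝 1) :=
      hu.comp ((tendsto_add_atTop_nat J₀).congr fun m => by ring)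
    have hγs : Tendsto (fun m => γ (s (J₀ + m))) atTop (𝓝 (γ 0)) :=
      hγan.continuousAt.tendsto.comp hsJ
    exact (hγs.mul tendsto_const_nhds).mul ((huJ.pow M').inv₀ (by simp))
  rw [one_pow, inv_one, mul_one] at hBt
  have hx : ∀ m, p' m (Sum.inl 1) = (Real.exp (α * t m) : ℂ) * B m := by
    intro m
    rw [hp'x₁]
    simp only [hB, ht, hα]
    rw [hsu (J₀ + m)]
    have hE : (Complex.exp (-(Real.log ((N₀ + (J₀ + m) : ℕ) : ℝ) : ℂ) / k) ^ M')⁻¹ =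
        (Real.exp ((M' : ℝ) / k * Real.log ((N₀ + (J₀ + m) : ℕ) : ℝ)) : ℂ) := by
      rw [← Complex.exp_nat_mul, ← Complex.exp_neg, Complex.ofReal_exp]
      congr 1
      push_cast
      field_simp
    rw [mul_pow, mul_pow, mul_inv, mul_inv, inv_pow, inv_inv, hE]
    ring
  have hgr := tendsto_growth_ratio_of_scaled hα0 htt hBt hzre hx
  have hdense' : UnprojectedDense S' := unprojectedDense_of_growth hS'irr hS'dim 1 hp'S hp'Γ hgr
  exact (unprojectedDense_latticeClosure_iff hUV hVU hS hne).1 hdense'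

variable (F : ℂ[X][X])

/-- **Polynomial fibres, transport + growth: case ∧ dense.**  `F` irreducible of `x₁`-degree
`≥ 2`; a place `x₀ = s^{-k}`, `x₁ = X₁(s) = Φ(s)s^{-M}` of `F = 0` (`Φ` analytic); `U ∈ SL₂(ℤ)` with
`U₁₀x₀ + U₁₁x₁ = γ(s)s^{-M'}` along it, `M' ≥ 1`, `Re(γ(0)z^{M'}) ≠ 0` for some `z^k = 2πi`; `R`
nonzero somewhere on the curve. [cite: MantovaMasser2023, §1 Further remarks, p. 5 (the question,
open in general)] (new) -/
theorem unprojectedDensityQuestion_planeCurve_polyFibre_transportedGrowth (hFirr : Irreducible F)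
    (hn : 2 ≤ F.natDegree) (U V : Matrix (Fin 2) (Fin 2) ℤ) (hUV : U * V = 1) (hVU : V * U = 1)
    {k M M' : ℕ} (hk : 1 ≤ k) (hM' : 1 ≤ M') {X₁ Φ γ : ℂ → ℂ} (hΦan : AnalyticAt ℂ Φ 0)
    (hγan : AnalyticAt ℂ γ 0) (hX₁ : ∀ᶠ s in 𝓝[≠] (0 : ℂ), X₁ s = Φ s * (s ^ M)⁻¹)
    (hγ : ∀ᶠ s in 𝓝[≠] (0 : ℂ), (U 1 0 : ℂ) * (s ^ k)⁻¹ + (U 1 1 : ℂ) * X₁ s = γ s * (s ^ M')⁻¹)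
    (hdir : ∃ z : ℂ, z ^ k = 2 * Real.pi * I ∧ (γ 0 * z ^ M').re ≠ 0)
    (hplace : ∀ᶠ s in 𝓝[≠] (0 : ℂ), (F.map (Polynomial.evalRingHom (s ^ k)⁻¹)).eval (X₁ s) = 0)
    (R : MvPolynomial (Fin 2) ℂ)
    (hR : ∃ x y : ℂ, (F.map (Polynomial.evalRingHom x)).eval y = 0 ∧ MvPolynomial.eval ![x, y] R ≠ 0) :
    MMCaseDimPiOneFree {w : Fin 2 ⊕ Fin 2 → ℂ |
        (F.map (Polynomial.evalRingHom (w (Sum.inl 0)))).eval (w (Sum.inl 1)) = 0 ∧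
        w (Sum.inr 0) = MvPolynomial.eval ![w (Sum.inl 0), w (Sum.inl 1)] R} ∧
      UnprojectedDense {w : Fin 2 ⊕ Fin 2 → ℂ |
        (F.map (Polynomial.evalRingHom (w (Sum.inl 0)))).eval (w (Sum.inl 1)) = 0 ∧
        w (Sum.inr 0) = MvPolynomial.eval ![w (Sum.inl 0), w (Sum.inl 1)] R} := by
  classical
  refine ⟨mmCase_planeCurve_polyFibre F hFirr hn R hR, ?_⟩
  obtain ⟨Φr, hΦr⟩ := exists_rowsEquiv
  set A : MvPolynomial (Fin 2) ℂ := Φr.symm F with hA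
  have hPQ : ∀ x y : ℂ, MvPolynomial.eval ![x, y] A = (F.map (Polynomial.evalRingHom x)).eval y := by
    intro x y
    rw [hΦr, hA, RingEquiv.apply_symm_apply]
  have hirrA : Irreducible A := (irreducible_rows_iff hPQ).2 hFirr
  have hset : {w : Fin 2 ⊕ Fin 2 → ℂ |
      (F.map (Polynomial.evalRingHom (w (Sum.inl 0)))).eval (w (Sum.inl 1)) = 0 ∧
      w (Sum.inr 0) = MvPolynomial.eval ![w (Sum.inl 0), w (Sum.inl 1)] R} =
      {w : Fin 2 ⊕ Fin 2 → ℂ | MvPolynomial.eval ![w (Sum.inl 0), w (Sum.inl 1)] A = 0 ∧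
        w (Sum.inr 0) = MvPolynomial.eval ![w (Sum.inl 0), w (Sum.inl 1)] R} := by
    ext w
    simp only [Set.mem_setOf_eq, hPQ]
  rw [hset]
  have hS := isIrreducibleClosed_curveGraphFibre R hirrA
  have hdim := zariskiDim_curveGraphFibre R hirrA
  have hndvd : ¬ F ∣ Φr R := by
    refine not_dvd_of_exists_eval_ne_zero F ?_
    obtain ⟨x, y, hxy, hne⟩ := hR
    exact ⟨x, y, hxy, by rw [← hΦr]; exact hne⟩
  have hplaceΦ : ∀ᶠ s in 𝓝[≠] (0 : ℂ),
      (F.map (Polynomial.evalRingHom (s ^ k)⁻¹)).eval (Φ s * (s ^ M)⁻¹) = 0 := by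
    filter_upwards [hplace, hX₁] with s hs hX
    rwa [hX] at hs
  obtain ⟨ψ, L, hψan, hψ0, hf⟩ :=
    exists_rows_place_normalForm F hFirr (by omega) (Φr R) hndvd hk M hΦan hplaceΦ
  refine unprojectedDense_transportedGrowth hS (le_of_eq hdim) U V hUV hVU hk hM' hγan hγ hdir L hψan
    hψ0 ?_
  filter_upwards [hplace, hf, hX₁] with s hs hfs hX
  refine ⟨?_, ?_⟩
  · simp only [Sum.elim_inl, Matrix.cons_val_zero, Matrix.cons_val_one]
    rw [hPQ]
    exact hs
  · simp only [Sum.elim_inr, Sum.elim_inl, Matrix.cons_val_zero, Matrix.cons_val_one]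
    rw [hΦr, hX, hfs]

end TransportedGrowth

/-! ## Example: the tangential cubic `(x₁ - x₀)³ = x₀` -/

section TangentialCubic

/-- Auxiliary computation for the example (`tangentialCubic_eval`). [folklore] -/
private theorem tangentialCubic_eval (x y : ℂ) :
    (((X - Polynomial.C (X : ℂ[X])) ^ 3 - Polynomial.C (X : ℂ[X]) : ℂ[X][X]).map
        (Polynomial.evalRingHom x)).eval y = (y - x) ^ 3 - x := by
  simp

/-- Auxiliary computation for the example (`tangentialCubic_eq`). [folklore] -/
private theorem tangentialCubic_eq :
    ((X - Polynomial.C (X : ℂ[X])) ^ 3 - Polynomial.C (X : ℂ[X]) : ℂ[X][X]) =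
      X ^ 3 + Polynomial.C (-3 * X : ℂ[X]) * X ^ 2 + Polynomial.C (3 * X ^ 2 : ℂ[X]) * X +
        Polynomial.C (-X ^ 3 - X : ℂ[X]) := by
  simp only [map_neg, map_mul, map_sub, map_pow, map_ofNat]
  ring

/-- Auxiliary computation for the example (`tangentialCubic_natDegree`). [folklore] -/
private theorem tangentialCubic_natDegree :
    ((X - Polynomial.C (X : ℂ[X])) ^ 3 - Polynomial.C (X : ℂ[X]) : ℂ[X][X]).natDegree = 3 := by
  rw [tangentialCubic_eq]; compute_degree!

/-- Auxiliary computation for the example (`tangentialCubic_coeff`). [folklore] -/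
private theorem tangentialCubic_coeff (j : ℕ) :
    ((X - Polynomial.C (X : ℂ[X])) ^ 3 - Polynomial.C (X : ℂ[X]) : ℂ[X][X]).coeff j =
      if j = 3 then 1 else if j = 2 then -3 * X else if j = 1 then 3 * X ^ 2
        else if j = 0 then -X ^ 3 - X else 0 := by
  rw [tangentialCubic_eq]
  simp only [Polynomial.coeff_add, Polynomial.coeff_X_pow, Polynomial.coeff_C_mul, Polynomial.coeff_X,
    Polynomial.coeff_C]
  rcases j with _ | _ | _ | _ | j <;> simp

/-- Auxiliary computation for the example (`tangentialCubic_monic`). [folklore] -/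
private theorem tangentialCubic_monic :
    ((X - Polynomial.C (X : ℂ[X])) ^ 3 - Polynomial.C (X : ℂ[X]) : ℂ[X][X]).Monic := by
  rw [Polynomial.Monic, Polynomial.leadingCoeff, tangentialCubic_natDegree, tangentialCubic_coeff]
  simp

/-- `(x₁ - x₀)³ - x₀` is irreducible (Eisenstein at `x₀`: the rows `-3x₀, 3x₀², -x₀³ - x₀`).
[folklore] -/
private theorem tangentialCubic_irreducible :
    Irreducible ((X - Polynomial.C (X : ℂ[X])) ^ 3 - Polynomial.C (X : ℂ[X]) : ℂ[X][X]) := by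
  set F : ℂ[X][X] := (X - Polynomial.C (X : ℂ[X])) ^ 3 - Polynomial.C (X : ℂ[X]) with hF
  have hP : (Ideal.span {(X : ℂ[X])}).IsPrime :=
    (Ideal.span_singleton_prime Polynomial.X_ne_zero).2 Polynomial.prime_X
  have hdeg : F.degree = 3 := by
    rw [Polynomial.degree_eq_natDegree tangentialCubic_monic.ne_zero, tangentialCubic_natDegree]; rfl
  refine Polynomial.irreducible_of_eisenstein_criterion hP ?_ ?_ ?_ ?_ tangentialCubic_monic.isPrimitive
  · rw [tangentialCubic_monic.leadingCoeff, Ideal.mem_span_singleton]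
    intro h
    have := Polynomial.natDegree_le_of_dvd h one_ne_zero
    rw [Polynomial.natDegree_X, Polynomial.natDegree_one] at this
    exact Nat.not_succ_le_zero 0 this
  · intro n hn
    rw [hdeg] at hn
    have hn3 : n < 3 := by exact_mod_cast hn
    rw [tangentialCubic_coeff, Ideal.mem_span_singleton]
    interval_cases n
    · simp only [show ¬ (0 : ℕ) = 3 by norm_num, show ¬ (0 : ℕ) = 2 by norm_num,
        show ¬ (0 : ℕ) = 1 by norm_num, if_false, if_true]
      exact ⟨-X ^ 2 - 1, by ring⟩
    · simp only [show ¬ (1 : ℕ) = 3 by norm_num, show ¬ (1 : ℕ) = 2 by norm_num, if_false, if_true]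
      exact ⟨3 * X, by ring⟩
    · simp only [show ¬ (2 : ℕ) = 3 by norm_num, if_false, if_true]
      exact ⟨-3, by ring⟩
  · rw [hdeg]; norm_num
  · rw [tangentialCubic_coeff, Ideal.span_singleton_pow, Ideal.mem_span_singleton]
    simp only [show ¬ (0 : ℕ) = 3 by norm_num, show ¬ (0 : ℕ) = 2 by norm_num,
      show ¬ (0 : ℕ) = 1 by norm_num, if_false, if_true]
    intro h
    -- `X² ∣ -X³ - X` would give `X² ∣ X`
    have h2 : (X : ℂ[X]) ^ 2 ∣ X := by
      have h3 : (X : ℂ[X]) ^ 2 ∣ X ^ 2 * (-X) - (-X ^ 3 - X) := dvd_sub (dvd_mul_right _ _) h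
      have e : (X : ℂ[X]) ^ 2 * (-X) - (-X ^ 3 - X) = X := by ring
      rwa [e] at h3
    have := Polynomial.natDegree_le_of_dvd h2 Polynomial.X_ne_zero
    rw [Polynomial.natDegree_pow, Polynomial.natDegree_X] at this
    omega

/-- **`{(x₁ - x₀)³ = x₀, y₀ = R(x₀, x₁)}`: case ∧ dense for every `R` nonzero somewhere on the
curve** (place `x₀ = s^{-3}`, `x₁ = s^{-3} + s^{-1}`; transport `x₁' = x₁ - x₀ = s^{-1}`,
`(k, M') = (3, 1)`, `3 ∤ 2`). [cite: MantovaMasser2023, §1 Further remarks, p. 5 (the question,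
open in general)] (new) -/
theorem unprojectedDensityQuestion_tangentialCubic_polyFibre (R : MvPolynomial (Fin 2) ℂ)
    (hR : ∃ x y : ℂ, (y - x) ^ 3 - x = 0 ∧ MvPolynomial.eval ![x, y] R ≠ 0) :
    MMCaseDimPiOneFree {w : Fin 2 ⊕ Fin 2 → ℂ |
        (w (Sum.inl 1) - w (Sum.inl 0)) ^ 3 - w (Sum.inl 0) = 0 ∧
        w (Sum.inr 0) = MvPolynomial.eval ![w (Sum.inl 0), w (Sum.inl 1)] R} ∧
      UnprojectedDense {w : Fin 2 ⊕ Fin 2 → ℂ |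
        (w (Sum.inl 1) - w (Sum.inl 0)) ^ 3 - w (Sum.inl 0) = 0 ∧
        w (Sum.inr 0) = MvPolynomial.eval ![w (Sum.inl 0), w (Sum.inl 1)] R} := by
  classical
  set F : ℂ[X][X] := (X - Polynomial.C (X : ℂ[X])) ^ 3 - Polynomial.C (X : ℂ[X]) with hF
  have hset : {w : Fin 2 ⊕ Fin 2 → ℂ |
      (w (Sum.inl 1) - w (Sum.inl 0)) ^ 3 - w (Sum.inl 0) = 0 ∧
      w (Sum.inr 0) = MvPolynomial.eval ![w (Sum.inl 0), w (Sum.inl 1)] R} =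
      {w : Fin 2 ⊕ Fin 2 → ℂ |
        (F.map (Polynomial.evalRingHom (w (Sum.inl 0)))).eval (w (Sum.inl 1)) = 0 ∧
        w (Sum.inr 0) = MvPolynomial.eval ![w (Sum.inl 0), w (Sum.inl 1)] R} := by
    ext w; simp only [Set.mem_setOf_eq, hF, tangentialCubic_eval]
  rw [hset]
  set U : Matrix (Fin 2) (Fin 2) ℤ := !![1, 0; -1, 1] with hU
  set V : Matrix (Fin 2) (Fin 2) ℤ := !![1, 0; 1, 1] with hV
  have hUV : U * V = 1 := by rw [hU, hV]; decide
  have hVU : V * U = 1 := by rw [hU, hV]; decide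
  -- the place and the transported coordinate
  set X₁ : ℂ → ℂ := fun s => (s ^ 3)⁻¹ + (s ^ 1)⁻¹ with hX₁
  have hX₁Φ : ∀ᶠ s in 𝓝[≠] (0 : ℂ), X₁ s = (fun s : ℂ => 1 + s ^ 2) s * (s ^ 3)⁻¹ := by
    filter_upwards [self_mem_nhdsWithin] with s (hs0 : s ≠ 0)
    simp only [hX₁, pow_one]
    field_simp
  have hγ : ∀ᶠ s in 𝓝[≠] (0 : ℂ), (U 1 0 : ℂ) * (s ^ 3)⁻¹ + (U 1 1 : ℂ) * X₁ s =
      (fun _ : ℂ => (1 : ℂ)) s * (s ^ 1)⁻¹ := by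
    filter_upwards [self_mem_nhdsWithin] with s (hs0 : s ≠ 0)
    simp [hU, hX₁]
  have hplace : ∀ᶠ s in 𝓝[≠] (0 : ℂ), (F.map (Polynomial.evalRingHom (s ^ 3)⁻¹)).eval (X₁ s) = 0 := by
    filter_upwards [self_mem_nhdsWithin] with s (hs0 : s ≠ 0)
    rw [hF, tangentialCubic_eval, hX₁]
    simp only [pow_one]
    field_simp
    ring
  have hdir : ∃ z : ℂ, z ^ 3 = 2 * Real.pi * I ∧ ((fun _ : ℂ => (1 : ℂ)) 0 * z ^ 1).re ≠ 0 :=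
    exists_direction_of_not_dvd (by norm_num) (by decide) one_ne_zero
  refine unprojectedDensityQuestion_planeCurve_polyFibre_transportedGrowth F tangentialCubic_irreducible
    (by rw [tangentialCubic_natDegree]; norm_num) U V hUV hVU (by norm_num) le_rfl
    ((analyticAt_const.add (analyticAt_id.pow 2))) analyticAt_const hX₁Φ hγ hdir hplace R ?_
  obtain ⟨x, y, hxy, hne⟩ := hR
  exact ⟨x, y, by rw [hF, tangentialCubic_eval]; exact hxy, hne⟩

end TangentialCubic

end Summit.Schanuel.Schanuel.Theorems

end
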